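import Mathlib
import HarnessLib
import Summits.NavierStokesRegularity.NavierStokesRegularity.Theorems.LoopPeriodRatchetNoPlanarExtremumSard
import Summits.NavierStokesRegularity.NavierStokesRegularity.Theorems.LoopPeriodRatchetNoPlanarExtremumOrbit
import Summits.NavierStokesRegularity.NavierStokesRegularity.Theorems.PoloidalWindowDoorPoloidalWindowRigidityHotLoopPrelim

/-!
# Route `PoloidalWindowDoor`, crux `PoloidalWindowRigidity` (K2, stmt-NavierStokesRegularity-19708) — THE HOT-LOOP LEMMA, LOCATED
# (line `loop_island`, ns-idea-8 g7, stub Z `stub_loopsPersist`): the closed orbit ringing an isolated compact hot piece lies IN ITS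
# PLANE and INSIDE THE GUARD

Cell ns-regularity-ideate, seat ns-poloidal-K2-p2 g12 (stub-worker on K2; `--supports` the crux item).

`exists_periodic_orbit_of_isolated_hot_piece_located`: the statement of the landed
`…HotLoopCore.exists_periodic_orbit_of_isolated_hot_piece` (K2-p2 g11: `X` a `C²` horizontal field, `f ∈ C³` a first integral,
`K ∋ y₀` an isolated compact hot piece of `f` in the horizontal plane through `y₀` with open guard `O`, `X ≠ 0` on the plane inside
`O ∖ K` ⇒ a non-stationary periodic orbit of `X`) with the two LOCATION clauses the persistence argument of stub Z needs and the
original statement forgets: the orbit starts in the plane of the piece (`γ 0 2 = y₀ 2`) and inside the guard (`γ 0 ∈ O`; indeed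
within `infDist · K < u/2 ≤ δ/20` of the piece, `cthickening δ K ⊆ O`).  The proof is the landed one VERBATIM (Hörmander cutoffs
around `K`, the collar `{u/2 ≤ infDist ≤ 9u}` on which `f < N`, a regular level `c ∈ (max_collar f, N)` from the tree's Sard
substitute, the level point on the ray from `y₀` before its first exit from `{infDist < u/2}`, and
`…Orbit.exists_periodic_orbit_of_regular_level` on the cut-off datum), reading off at the end the two facts about the base point
`p = γ 0` that the construction provides (`p 2 = y₀ 2`, `infDist p K < u/2`); the unlocated lemma follows by dropping them.

WHAT THIS IS NOT: not a claim about Navier–Stokes — planar topology (Liouville–Arnold with one degree of freedom) for one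
provable stub of an ideator line of a door route (bears_on LADDER-NS N0, rung N0-LocalTubeDoorPoloidal).
-/

noncomputable section

-- the summit and its single sub-problem share the name (CONVENTIONS §1), as in every Theorems file
set_option linter.dupNamespace false

namespace Summit.NavierStokesRegularity.NavierStokesRegularity.Theorems.PoloidalWindowDoorPoloidalWindowRigidityHotLoopCoreLocated

open Set Function Filter Topology Metric
open Summit.NavierStokesRegularity.NavierStokesRegularity.Theorems.LoopPeriodRatchetNoPlanarExtremumSard
open Summit.NavierStokesRegularity.NavierStokesRegularity.Theorems.LoopPeriodRatchetNoPlanarExtremumOrbit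
open Summit.NavierStokesRegularity.NavierStokesRegularity.Theorems.PoloidalWindowDoorPoloidalWindowRigidityHotLoopPrelim

/-- **THE HOT-LOOP LEMMA, LOCATED.**  `X : ℝ³ → ℝ³` of class `C²` with `X₂ ≡ 0`, `f ∈ C³` with `Df(X) ≡ 0`, `f ≤ N` on the
horizontal plane through `y₀` inside `O`; `K ∋ y₀` compact inside that plane with `f = N` on `K`; `O ⊇ K` open with
`{f = N} ∩ plane ∩ O ⊆ K`; `X ≠ 0` on `(O ∩ plane) ∖ K`.  Then `y′ = X(y)` has a periodic orbit `γ` with a period `ℓ > 0`,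
`X (γ 0) ≠ 0`, STARTING IN THE PLANE (`γ 0 2 = y₀ 2`) AND INSIDE THE GUARD (`γ 0 ∈ O`).  Proof = the landed
`…HotLoopCore.exists_periodic_orbit_of_isolated_hot_piece` verbatim, plus the two read-offs. [folklore] -/
theorem exists_periodic_orbit_of_isolated_hot_piece_located
    {X : EuclideanSpace ℝ (Fin 3) → EuclideanSpace ℝ (Fin 3)} (hX : ContDiff ℝ 2 X) (hX2 : ∀ y, X y 2 = 0)
    {f : EuclideanSpace ℝ (Fin 3) → ℝ} (hf : ContDiff ℝ 3 f) (hfX : ∀ y, fderiv ℝ f y (X y) = 0)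
    {N : ℝ} {y₀ : EuclideanSpace ℝ (Fin 3)}
    {K O : Set (EuclideanSpace ℝ (Fin 3))} (hK : IsCompact K) (hy₀ : y₀ ∈ K)
    (hKf : ∀ y ∈ K, y 2 = y₀ 2 ∧ f y = N) (hO : IsOpen O) (hKO : K ⊆ O)
    (hfle : ∀ y : EuclideanSpace ℝ (Fin 3), y 2 = y₀ 2 → y ∈ O → f y ≤ N)
    (hiso : ∀ y ∈ O, y 2 = y₀ 2 → f y = N → y ∈ K)
    (hXne : ∀ y ∈ O, y 2 = y₀ 2 → y ∉ K → X y ≠ 0) :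
    ∃ (γ : ℝ → EuclideanSpace ℝ (Fin 3)) (ℓ : ℝ), 0 < ℓ ∧ (∀ θ, HasDerivAt γ (X (γ θ)) θ) ∧
      (∀ θ, γ (θ + ℓ) = γ θ) ∧ X (γ 0) ≠ 0 ∧ γ 0 2 = y₀ 2 ∧ γ 0 ∈ O := by
  have hKne : K.Nonempty := ⟨y₀, hy₀⟩
  have hKc : IsClosed K := hK.isClosed
  have hf2 : ContDiff ℝ 2 f := hf.of_le (by norm_num)
  have hf1 : ContDiff ℝ 1 f := hf.of_le (by norm_num)
  have hfd : Differentiable ℝ f := hf1.differentiable one_ne_zero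
  have hfc : Continuous f := hf.continuous
  set d : EuclideanSpace ℝ (Fin 3) → ℝ := fun y => infDist y K with hd
  have hdc : Continuous d := continuous_infDist_pt K
  have hd0 : ∀ y ∈ K, d y = 0 := fun y hy => infDist_zero_of_mem hy
  -- (a) the scale `u`: `cthickening (10u) K ⊆ O`, and a radius `R₀` for `K`
  obtain ⟨δ, hδ, hδO⟩ := hK.exists_cthickening_subset_open hO hKO
  set u : ℝ := δ / 10 with hu
  have hu0 : 0 < u := by positivity
  have hinO : ∀ y, d y ≤ 9 * u → y ∈ O := fun y hy => by
    refine hδO (thickening_subset_cthickening δ K ((mem_thickening_iff_infDist_lt hKne).2 ?_))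
    show infDist y K < δ
    have : d y < δ := by rw [hu] at hy; linarith
    exact this
  obtain ⟨R₀, hKR⟩ := hK.isBounded.subset_closedBall y₀
  have hR₀ : 0 ≤ R₀ := by
    have h := hKR hy₀
    rw [mem_closedBall, dist_self] at h
    exact h
  set e0 : EuclideanSpace ℝ (Fin 3) := EuclideanSpace.single 0 1 with he0
  set e1 : EuclideanSpace ℝ (Fin 3) := EuclideanSpace.single 1 1 with he1
  set e2 : EuclideanSpace ℝ (Fin 3) := EuclideanSpace.single 2 1 with he2
  have hne0 : ‖e0‖ = 1 := by simp [he0]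
  -- (b) the collar `A = {u/2 ≤ d ≤ 9u} ∩ plane` and its maximum `μ₁ < N`
  set A : Set (EuclideanSpace ℝ (Fin 3)) := {y | y 2 = y₀ 2 ∧ u / 2 ≤ d y ∧ d y ≤ 9 * u} with hA
  have hplane_closed : IsClosed {y : EuclideanSpace ℝ (Fin 3) | y 2 = y₀ 2} :=
    isClosed_eq (EuclideanSpace.proj (2 : Fin 3)).continuous continuous_const
  have hAclosed : IsClosed A := by
    rw [hA, Set.setOf_and, Set.setOf_and]
    exact hplane_closed.inter ((isClosed_le continuous_const hdc).inter (isClosed_le hdc continuous_const))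
  have hAbdd : A ⊆ closedBall y₀ (R₀ + (9 * u + 1)) := fun y hy =>
    mem_closedBall.2 (dist_lt_of_infDist_lt hKne hKR (by linarith [hy.2.2] : d y < 9 * u + 1)).le
  have hAc : IsCompact A := (isCompact_closedBall y₀ _).of_isClosed_subset hAclosed hAbdd
  have hAlt : ∀ y ∈ A, f y < N := by
    intro y hy
    have hyO : y ∈ O := hinO y hy.2.2
    have hyK : y ∉ K := fun h => by have := hd0 y h; linarith [hy.2.1]
    exact lt_of_le_of_ne (hfle y hy.1 hyO) fun h => hyK (hiso y hyO hy.1 h)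
  -- the first exit of the ray `y₀ + s•e0` from `{d < u/2}` gives a point of `A`
  set g : ℝ → ℝ := fun s => d (y₀ + s • e0) with hg
  have hgc : Continuous g := hdc.comp (by fun_prop)
  have hg0 : g 0 < u / 2 := by
    have : g 0 = 0 := by simp only [hg, zero_smul, add_zero]; exact hd0 y₀ hy₀
    rw [this]; positivity
  have hgS : u / 2 ≤ g (R₀ + u / 2) := le_infDist_ray hKne hne0 hKR
  obtain ⟨s₁, hs₁0, -, hgs₁, hbefore⟩ := exists_first_exit hgc (by linarith) hg0 hgS
  set q : EuclideanSpace ℝ (Fin 3) := y₀ + s₁ • e0 with hq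
  have hq2 : q 2 = y₀ 2 := by simp [hq, he0]
  have hqA : q ∈ A := ⟨hq2, by rw [← hgs₁], by rw [show d q = g s₁ from rfl, hgs₁]; linarith⟩
  obtain ⟨a, haA, hamax⟩ := hAc.exists_isMaxOn ⟨q, hqA⟩ hfc.continuousOn
  set μ₁ : ℝ := f a with hμ₁
  have hμ₁N : μ₁ < N := hAlt a haA
  have hAle : ∀ y ∈ A, f y ≤ μ₁ := fun y hy => hamax hy
  -- (c) a regular level `c ∈ (μ₁, N)` of `f` (Sard substitute for the Hamiltonian field of `f`)
  set Xf : EuclideanSpace ℝ (Fin 3) → EuclideanSpace ℝ (Fin 3) :=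
    fun y => fderiv ℝ f y e1 • e0 + (-fderiv ℝ f y e0) • e1 with hXf
  have hXfc : ContDiff ℝ 2 Xf := by
    have h0 : ContDiff ℝ 2 fun y => fderiv ℝ f y e0 := (hf.fderiv_right (m := 2) (by norm_num)).clm_apply contDiff_const
    have h1 : ContDiff ℝ 2 fun y => fderiv ℝ f y e1 := (hf.fderiv_right (m := 2) (by norm_num)).clm_apply contDiff_const
    exact (h1.smul contDiff_const).add (h0.neg.smul contDiff_const)
  have hXf0 : ∀ y, Xf y 0 = fderiv ℝ f y e1 := fun y => by simp [hXf, he0, he1]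
  have hXf1 : ∀ y, Xf y 1 = -fderiv ℝ f y e0 := fun y => by simp [hXf, he0, he1]
  have hψ0 : ∀ y, fderiv ℝ f y (EuclideanSpace.single 0 1) = -(Xf y 1) := fun y => by rw [hXf1, neg_neg]
  have hψ1 : ∀ y, fderiv ℝ f y (EuclideanSpace.single 1 1) = Xf y 0 := fun y => (hXf0 y).symm
  obtain ⟨c, hc, hreg⟩ := exists_regular_level hXfc hfd hψ0 hψ1 y₀ (R₀ + u) hμ₁N
  -- (d) a level point `p` with `d p < u/2`
  set F : ℝ → ℝ := fun s => f (y₀ + s • e0) with hF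
  have hFc : Continuous F := hfc.comp (by fun_prop)
  have hF0 : F 0 = N := by simp only [hF, zero_smul, add_zero]; exact (hKf y₀ hy₀).2
  have hF1 : F s₁ ≤ μ₁ := hAle q hqA
  obtain ⟨s₂, hs₂, hFs₂⟩ : c ∈ F '' Icc 0 s₁ :=
    intermediate_value_Icc' hs₁0.le hFc.continuousOn ⟨by linarith [hc.1], by rw [hF0]; exact hc.2.le⟩
  have hs₂lt : s₂ < s₁ := by
    rcases hs₂.2.lt_or_eq with h | h
    · exact h
    · exfalso; rw [h] at hFs₂; linarith [hc.1]
  set p : EuclideanSpace ℝ (Fin 3) := y₀ + s₂ • e0 with hp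
  have hp2 : p 2 = y₀ 2 := by simp [hp, he0]
  have hpd : d p < u / 2 := hbefore s₂ hs₂.1 hs₂lt
  have hpf : f p = c := hFs₂
  -- (e) the cut-off level-curve datum
  obtain ⟨ρ, hρs, hρ0, hρ1, hρ_one, hρ_zero⟩ := exists_cutoff_infDist hKne hu0
  obtain ⟨ρ', hρ's, hρ'0, hρ'1, hρ'_one, hρ'_zero⟩ := exists_cutoff_infDist hKne (u := 3 * u) (by positivity)
  have hρc : ContDiff ℝ 1 ρ := hρs.of_le (by exact_mod_cast le_top)
  have hρ'c : ContDiff ℝ 1 ρ' := hρ's.of_le (by exact_mod_cast le_top)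
  set H0 : EuclideanSpace ℝ (Fin 3) → ℝ := fun y => ρ' y * (c - f y) + (1 - ρ' y) with hH0
  set H1 : EuclideanSpace ℝ (Fin 3) → ℝ := fun y => y 2 - y₀ 2 with hH1
  set Hc : Fin 2 → EuclideanSpace ℝ (Fin 3) → ℝ := ![H0, H1] with hHc
  set H : EuclideanSpace ℝ (Fin 3) → (Fin 2 → ℝ) := fun y i => Hc i y with hH
  set V : EuclideanSpace ℝ (Fin 3) → EuclideanSpace ℝ (Fin 3) := fun y => ρ y • X y with hV
  have hHapp0 : ∀ y, H y 0 = H0 y := fun y => rfl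
  have hHapp1 : ∀ y, H y 1 = H1 y := fun y => rfl
  -- the linearised datum near the hot piece
  set G0 : EuclideanSpace ℝ (Fin 3) → ℝ := fun y => c - f y with hG0
  set Gc : Fin 2 → EuclideanSpace ℝ (Fin 3) → ℝ := ![G0, H1] with hGc
  set G : EuclideanSpace ℝ (Fin 3) → (Fin 2 → ℝ) := fun y i => Gc i y with hG
  have hH0c : ContDiff ℝ 1 H0 := (hρ'c.mul (contDiff_const.sub hf1)).add (contDiff_const.sub hρ'c)
  have hc2 : ContDiff ℝ 1 (fun y : EuclideanSpace ℝ (Fin 3) => y 2) :=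
    (EuclideanSpace.proj (2 : Fin 3) : EuclideanSpace ℝ (Fin 3) →L[ℝ] ℝ).contDiff
  have hH1c : ContDiff ℝ 1 H1 := hc2.sub contDiff_const
  have hG0c : ContDiff ℝ 1 G0 := contDiff_const.sub hf1
  have hHcd : ContDiff ℝ 1 H := by
    rw [hH, contDiff_pi]
    exact Fin.forall_fin_two.2 ⟨hH0c, hH1c⟩
  have hVcd : ContDiff ℝ 1 V := hρc.smul (hX.of_le one_le_two)
  have hH1d : ∀ y w, fderiv ℝ H1 y w = w 2 := by
    intro y w
    have h : HasFDerivAt (fun y : EuclideanSpace ℝ (Fin 3) => y 2 - y₀ 2)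
        (EuclideanSpace.proj (2 : Fin 3) : EuclideanSpace ℝ (Fin 3) →L[ℝ] ℝ) y :=
      ((EuclideanSpace.proj (2 : Fin 3) : EuclideanSpace ℝ (Fin 3) →L[ℝ] ℝ).hasFDerivAt).sub_const (y₀ 2)
    rw [hH1, h.fderiv]; rfl
  have hG0d : ∀ y w, fderiv ℝ G0 y w = -fderiv ℝ f y w := by
    intro y w; rw [hG0, fderiv_const_sub, _root_.neg_apply]
  have hGd : ∀ y w, fderiv ℝ G y w = ![-fderiv ℝ f y w, w 2] := by
    intro y w
    rw [hG, fderiv_pi (Fin.forall_fin_two.2 ⟨(hG0c.differentiable one_ne_zero) y, (hH1c.differentiable one_ne_zero) y⟩)]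
    ext i
    fin_cases i
    · simp [hGc, hG0d]
    · simp [hGc, hH1d]
  -- near the hot piece (`d < 3u`), `H` agrees with `G`
  have hHG : ∀ y : EuclideanSpace ℝ (Fin 3), d y < 3 * u → H =ᶠ[𝓝 y] G := by
    intro y hy
    have hopen : IsOpen {z : EuclideanSpace ℝ (Fin 3) | d z < 3 * u} := isOpen_lt hdc continuous_const
    filter_upwards [hopen.mem_nhds hy] with y' hy'
    funext i
    fin_cases i
    · show H0 y' = G0 y'
      simp only [hH0, hG0, hρ'_one y' hy', one_mul, sub_self, add_zero]
    · rfl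
  have hfdH : ∀ y : EuclideanSpace ℝ (Fin 3), d y < 3 * u → ∀ w,
      fderiv ℝ H y w = ![-fderiv ℝ f y w, w 2] := by
    intro y hy w
    rw [(hHG y hy).fderiv_eq, hGd]
  -- (ii) `dH(V) = 0` everywhere
  have hHV : ∀ y, fderiv ℝ H y (V y) = 0 := by
    intro y
    by_cases hy : d y < 3 * u
    · rw [hfdH y hy]
      have h1 : fderiv ℝ f y (V y) = 0 := by
        rw [hV]; dsimp only; rw [map_smul, hfX, smul_zero]
      have h2 : V y 2 = 0 := by simp [hV, hX2]
      rw [h1, h2, neg_zero]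
      ext i; fin_cases i <;> rfl
    · have h0 : V y = 0 := by
        rw [hV]; dsimp only; rw [hρ_zero y (not_lt.1 hy), zero_smul]
      rw [h0, map_zero]
  -- the zero set of `H`
  have hzero : ∀ y, H y = 0 → y 2 = y₀ 2 ∧ d y < u / 2 ∧ f y = c := by
    intro y hHy
    have h0 : H0 y = 0 := by rw [← hHapp0]; exact congrFun hHy 0
    have h1 : H1 y = 0 := by rw [← hHapp1]; exact congrFun hHy 1
    have hy2 : y 2 = y₀ 2 := sub_eq_zero.1 h1
    have hyd : d y < u / 2 := by
      by_contra hge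
      rw [not_lt] at hge
      by_cases hfar : 9 * u ≤ d y
      · have hρ'y : ρ' y = 0 := hρ'_zero y (by show 3 * (3 * u) ≤ infDist y K; linarith)
        have : H0 y = 1 := by simp only [hH0, hρ'y, zero_mul, sub_zero, zero_add]
        rw [this] at h0; exact one_ne_zero h0
      · rw [not_le] at hfar
        have hyA : y ∈ A := ⟨hy2, hge, hfar.le⟩
        have hpos : 0 < c - f y := by linarith [hAle y hyA, hc.1]
        have hval : ρ' y * (c - f y) + (1 - ρ' y) = 0 := h0
        nlinarith [mul_nonneg (hρ'0 y) hpos.le, hρ'1 y]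
    refine ⟨hy2, hyd, ?_⟩
    have : H0 y = c - f y := by
      simp only [hH0, hρ'_one y (by linarith), one_mul, sub_self, add_zero]
    rw [this] at h0; linarith
  -- (iii) `V ≠ 0` on the zero set
  have hXne' : ∀ y, H y = 0 → X y ≠ 0 := by
    intro y hHy
    obtain ⟨hy2, hyd, hyf⟩ := hzero y hHy
    refine hXne y (hinO y (by linarith)) hy2 fun hyK => ?_
    have := (hKf y hyK).2
    linarith [hc.2]
  have hVX : ∀ y, H y = 0 → V y = X y := by
    intro y hHy
    obtain ⟨-, hyd, -⟩ := hzero y hHy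
    rw [hV]; dsimp only; rw [hρ_one y (by linarith), one_smul]
  have hne : ∀ y, H y = 0 → V y ≠ 0 := fun y hHy => by rw [hVX y hHy]; exact hXne' y hHy
  -- (iv) `dH` onto on the zero set
  have hsurj : ∀ y, H y = 0 → Function.Surjective (fderiv ℝ H y) := by
    intro y hHy g'
    obtain ⟨hy2, hyd, hyf⟩ := hzero y hHy
    have hy3 : d y < 3 * u := by linarith
    set u₀ : ℝ := fderiv ℝ f y e0 with hu₀
    set u₁ : ℝ := fderiv ℝ f y e1 with hu₁
    set u₂ : ℝ := fderiv ℝ f y e2 with hu₂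
    have hN : 0 < u₀ ^ 2 + u₁ ^ 2 := by
      have hdist : dist y y₀ ≤ R₀ + u := (dist_lt_of_infDist_lt hKne hKR (by linarith : d y < u)).le
      have h := hreg y hy2 hdist hyf
      rw [hXf0, hXf1] at h
      have h' : u₀ ≠ 0 ∨ u₁ ≠ 0 := by
        by_contra hcon
        simp only [not_or, not_ne_iff] at hcon
        exact h ⟨by rw [← hu₁, hcon.2], by rw [← hu₀, hcon.1, neg_zero]⟩
      rcases h' with h' | h'
      · have := sq_pos_of_ne_zero h'; positivity
      · have := sq_pos_of_ne_zero h'; positivity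
    set lam : ℝ := (-g' 0 - g' 1 * u₂) / (u₀ ^ 2 + u₁ ^ 2) with hlam
    refine ⟨lam • (u₀ • e0 + u₁ • e1) + g' 1 • e2, ?_⟩
    rw [hfdH y hy3]
    have hlin : fderiv ℝ f y (lam • (u₀ • e0 + u₁ • e1) + g' 1 • e2) =
        lam * (u₀ * u₀ + u₁ * u₁) + g' 1 * u₂ := by
      rw [map_add, map_smul, map_add, map_smul, map_smul, map_smul, ← hu₀, ← hu₁, ← hu₂]
      simp only [smul_eq_mul]
    have hval : -(lam * (u₀ * u₀ + u₁ * u₁) + g' 1 * u₂) = g' 0 := by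
      have hN' : u₀ * u₀ + u₁ * u₁ = u₀ ^ 2 + u₁ ^ 2 := by ring
      rw [hN', hlam, div_mul_cancel₀ _ hN.ne']
      ring
    have hcoord : (lam • (u₀ • e0 + u₁ • e1) + g' 1 • e2) 2 = g' 1 := by
      rw [he0, he1, he2]
      simp [PiLp.add_apply, PiLp.smul_apply]
    rw [hlin, hval, hcoord]
    ext i; fin_cases i <;> rfl
  -- boundedness of the zero set and membership of `p`
  have hbdd : ∀ y, H y = 0 → ‖y‖ ≤ ‖y₀‖ + (R₀ + u) := by
    intro y hHy
    obtain ⟨-, hyd, -⟩ := hzero y hHy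
    have hdist : dist y y₀ < R₀ + u := dist_lt_of_infDist_lt hKne hKR (by linarith : d y < u)
    rw [dist_eq_norm] at hdist
    calc ‖y‖ = ‖(y - y₀) + y₀‖ := by rw [sub_add_cancel]
      _ ≤ ‖y - y₀‖ + ‖y₀‖ := norm_add_le _ _
      _ ≤ ‖y₀‖ + (R₀ + u) := by linarith
  have hHp : H p = 0 := by
    funext i
    fin_cases i
    · show H0 p = 0
      simp only [hH0, hρ'_one p (by linarith), one_mul, sub_self, add_zero, hpf]
    · show H1 p = 0
      simp only [hH1, hp2, sub_self]
  -- (f) the periodic orbit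
  obtain ⟨γ, ℓ, hℓ, hγ, hγper, hγ0, hγH⟩ :=
    exists_periodic_orbit_of_regular_level hHcd hVcd hHV hne hsurj hbdd hHp
  refine ⟨γ, ℓ, hℓ, fun θ => ?_, hγper, ?_, ?_, ?_⟩
  · have h := hγ θ
    rwa [hVX _ (hγH θ)] at h
  · rw [hγ0]; exact hXne' p hHp
  · rw [hγ0]; exact hp2
  · rw [hγ0]; exact hinO p (by linarith)

end Summit.NavierStokesRegularity.NavierStokesRegularity.Theorems.PoloidalWindowDoorPoloidalWindowRigidityHotLoopCoreLocated

end
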